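import Summits.Ventures.HSemireg.PhaseTorusBoxHosting

/-!
# THE 8-SET DICHOTOMY on the phase torus `(μ₄)⁴` and the phase-torus law at corank `≤ 8`, unconditional
# (HSemireg support file; phase-torus line, corank threshold, module 4 of 4)

Crux of record: `Summit.HodgeConjecture.HodgeConjecture.Theses.EightfoldBlochSeeds.BlochSeedDiscOne`
(= `HasHyperbolicBlochSeed 4 1`, item stmt-HodgeConjecture-18881; skeleton `Lines/birth.lean`, STUB R `stub_rung_pad4_seedAt`,
named technique = PAD-4 two-level ⊕-block design with a TWO-TERM line-bundle presentation).
Nothing in this file proves HC, HC_AV, HC_CM, H2 or item 18881; census-neutral (no SAT∕UNSAT row is added or changed).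

WHAT THIS FILE IS (tree copy of §7.3–§7.4 of the crux workfile `Cruxes/BlochSeedDiscOne/PhaseTorusLawAllCoranks.lean` b3a30e3be1a62a1c,
author s4-prove-2 g0, director-hodge R19.171 block F1 targets (a) `phaseTorusLaw8_holds` and (b) `not_phaseTorusLaw16`; statements verbatim;
pen: `PHASE-TORUS-ALLCORANK-s4p2.md` f9de3e256e8a2f46; machine cross-check of the dichotomy `py/tiling8.py` + `py/cliques.py` (the non-hosted
8-subsets of `(ℤ/4)⁴` are exactly the 32 cosets of `E8`) — not used by the kernel proof):
* §7.3 for a NON-box-hosted `A` with `|A| ≤ 8` (section hypotheses `hA8`, `hN`; structure lemmas of `PhaseTorusBoxHosting`): no odd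
  difference (`diff_ne_one`), all differences even (`diff_even`) and of even weight, i.e. **`sub_mem_e8Set`**; hence `A` lies in the
  `E8`-coset of any of its points (`subset_e8_coset`);
* §7.4 **`eightDichotomy_holds`** (every set of `≤ 8` phases is box-hosted or inside an `E8`-coset), **`phaseTorusLaw8_holds : PhaseTorusLawN 8`**
  (box-hosted law + E8 law), `not_phaseTorusLaw16` (alias), and **`threshold_kernel`**: the law holds at every corank `≤ 8` and fails at
  every corank `≥ 16`.
Everything here is PROVED (axioms `propext`, `Classical.choice`, `Quot.sound`; no `sorry`, no named fact, no instance, no notation).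

WHAT IT IS NOT: a statement about sheaves, monads, a SOURCE or a SEED.  Coranks `9…15`: `≤ 10` holds (`PhaseTorusLawTen.phaseTorusLawN_ten`,
control g6's box-mass law); the crux-dir value `γ* = 14` (pen + machine, memo BOX-LAW-g6.md; `PhaseTorusLawN14.not_phaseTorusLawN_fourteen`
is a crux workfile) is not a tree theorem here.
Tree filing: hsemireg-phasetorus-typer-1 g2.
-/

namespace Summit.Ventures.HSemireg.PhaseTorus

open Finset BigOperators

/-! ## §7.3 All pairwise differences of a non-hosted set of `≤ 8` phases lie in `E8` -/

section structure_

variable {A : Finset PT} (hA8 : A.card ≤ 8) (hN : ∀ (f₀ : Fin 4) (s : Fin 4 → ZMod 4), ¬ BoxHosted A f₀ s)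
include hA8 hN

/-- **no odd difference** `b g = a g + 1`. -/
theorem diff_ne_one {a b : PT} (ha : a ∈ A) (hb : b ∈ A) (g : Fin 4) : b g ≠ a g + 1 := by
  intro hbg
  have hab : a ≠ b := by
    rintro rfl
    have : ∀ x : ZMod 4, x ≠ x + 1 := by decide
    exact this _ hbg
  obtain ⟨h₁, h1g, -⟩ := exists_other g g
  by_cases hclose : ∃ h, h ≠ g ∧ (b h = a h ∨ b h = a h + 1 ∨ b h = a h + 3)
  · -- Case A: a second close coordinate h
    obtain ⟨h, hhg, hbh⟩ := hclose
    -- the pair at h through a h and b h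
    obtain ⟨t₂, hat, hbt⟩ : ∃ t₂ : ZMod 4, (a h = t₂ ∨ a h = t₂ + 1) ∧ (b h = t₂ ∨ b h = t₂ + 1) := by
      have key : ∀ x y : ZMod 4, (y = x ∨ y = x + 1 ∨ y = x + 3) →
          ∃ t : ZMod 4, (x = t ∨ x = t + 1) ∧ (y = t ∨ y = t + 1) := by decide
      exact key _ _ hbh
    -- Box₁ = (g : {a g, a g+1}) × (h : t₂) ∋ a, b ;  Box₂ = (g : {a g − 1, a g}) × (h : t₂) ∋ a, p
    have haB1 : a ∈ box A g (a g) h t₂ := mem_box.2 ⟨ha, Or.inl rfl, hat⟩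
    have hbB1 : b ∈ box A g (a g) h t₂ := mem_box.2 ⟨hb, Or.inr hbg, hbt⟩
    have haB2 : a ∈ box A g (a g + 3) h t₂ := mem_box.2 ⟨ha, mem_pair_pred _, hat⟩
    obtain ⟨p, hpB2, hpa⟩ := exists_partner hA8 hN (Ne.symm hhg) (a g + 3) t₂ a
    obtain ⟨hp, hpg, hpt⟩ := mem_box.1 hpB2
    -- the two remaining coordinates
    obtain ⟨h₂, h₃, h2g, h3g, h23⟩ := exists_two_others g
    -- hmm: we need h₂, h₃ ≠ g AND ≠ h; choose them as the two coordinates off {g, h}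
    obtain ⟨k₂, k2g, k2h⟩ := exists_other g h
    obtain ⟨k₃, hk₃⟩ : ∃ k₃ : Fin 4, k₃ ≠ g ∧ k₃ ≠ h ∧ k₃ ≠ k₂ := by
      have key : ∀ g h k₂ : Fin 4, h ≠ g → k₂ ≠ g → k₂ ≠ h → ∃ k₃ : Fin 4, k₃ ≠ g ∧ k₃ ≠ h ∧ k₃ ≠ k₂ := by decide
      exact key g h k₂ hhg k2g k2h
    obtain ⟨k3g, k3h, k32⟩ := hk₃
    -- b and p both sit at a + 2 on k₂, k₃
    have hb2 := opp_of_box hA8 hN (Ne.symm hhg) (a g) t₂ haB1 hbB1 hab k₂ k2g k2h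
    have hb3 := opp_of_box hA8 hN (Ne.symm hhg) (a g) t₂ haB1 hbB1 hab k₃ k3g k3h
    have hp2 := opp_of_box hA8 hN (Ne.symm hhg) (a g + 3) t₂ haB2 hpB2 (Ne.symm hpa) k₂ k2g k2h
    have hp3 := opp_of_box hA8 hN (Ne.symm hhg) (a g + 3) t₂ haB2 hpB2 (Ne.symm hpa) k₃ k3g k3h
    -- so p, b share the box (k₂ : {b k₂}) × (k₃ : {b k₃}); they differ (at g)
    have hpb : p ≠ b := by
      rintro rfl
      have key : ∀ x : ZMod 4, ¬((x + 1 = x + 3) ∨ (x + 1 = x + 3 + 1)) := by decide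
      exact key _ (hbg ▸ hpg)
    have hpB3 : p ∈ box A k₂ (b k₂) k₃ (b k₃) := mem_box.2 ⟨hp, Or.inl (hp2.trans hb2.symm), Or.inl (hp3.trans hb3.symm)⟩
    have hbB3 : b ∈ box A k₂ (b k₂) k₃ (b k₃) := mem_box.2 ⟨hb, Or.inl rfl, Or.inl rfl⟩
    have hh2 := opp_of_box hA8 hN k32.symm (b k₂) (b k₃) hpB3 hbB3 hpb h (Ne.symm k2h) (Ne.symm k3h)
    -- but b h, p h ∈ {t₂, t₂+1}: not opposite
    have key : ∀ x y t : ZMod 4, (x = t ∨ x = t + 1) → (y = t ∨ y = t + 1) → y ≠ x + 2 := by decide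
    exact key _ _ _ hpt hbt hh2
  · -- Case B: every other coordinate is opposite
    push Not at hclose
    have hfar : ∀ h, h ≠ g → b h = a h + 2 := by
      intro h hh
      obtain ⟨h1, h2, h3⟩ := hclose h hh
      have key : ∀ x y : ZMod 4, y ≠ x → y ≠ x + 1 → y ≠ x + 3 → y = x + 2 := by decide
      exact key _ _ h1 h2 h3
    obtain ⟨k₂, k₃, k2g, k3g, k23⟩ := exists_two_others g
    obtain ⟨k₁, hk1g, hk12, hk13⟩ : ∃ k₁ : Fin 4, k₁ ≠ g ∧ k₁ ≠ k₂ ∧ k₁ ≠ k₃ := by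
      have key : ∀ g k₂ k₃ : Fin 4, ∃ k₁ : Fin 4, k₁ ≠ g ∧ k₁ ≠ k₂ ∧ k₁ ≠ k₃ := by decide
      exact key g k₂ k₃
    -- Box₁ = (g : {a g, a g+1}) × (k₁ : {a k₁, a k₁+1}) ∋ a; partner p
    have haB1 : a ∈ box A g (a g) k₁ (a k₁) := mem_box.2 ⟨ha, Or.inl rfl, Or.inl rfl⟩
    obtain ⟨p, hpB1, hpa⟩ := exists_partner hA8 hN (Ne.symm hk1g) (a g) (a k₁) a
    obtain ⟨hp, hpg, hpk⟩ := mem_box.1 hpB1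
    have hp2 := opp_of_box hA8 hN (Ne.symm hk1g) (a g) (a k₁) haB1 hpB1 (Ne.symm hpa) k₂ k2g (Ne.symm hk12)
    have hp3 := opp_of_box hA8 hN (Ne.symm hk1g) (a g) (a k₁) haB1 hpB1 (Ne.symm hpa) k₃ k3g (Ne.symm hk13)
    have hb2 := hfar k₂ k2g
    have hb3 := hfar k₃ k3g
    have hpb : p ≠ b := by
      rintro rfl
      have key : ∀ x : ZMod 4, ¬(x + 2 = x ∨ x + 2 = x + 1) := by decide
      exact key _ ((hfar k₁ hk1g) ▸ hpk)
    have hpB3 : p ∈ box A k₂ (b k₂) k₃ (b k₃) := mem_box.2 ⟨hp, Or.inl (hp2.trans hb2.symm), Or.inl (hp3.trans hb3.symm)⟩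
    have hbB3 : b ∈ box A k₂ (b k₂) k₃ (b k₃) := mem_box.2 ⟨hb, Or.inl rfl, Or.inl rfl⟩
    have hhg := opp_of_box hA8 hN k23 (b k₂) (b k₃) hpB3 hbB3 hpb g (Ne.symm k2g) (Ne.symm k3g)
    -- b g = a g + 1 and p g ∈ {a g, a g+1}: not opposite
    have key : ∀ x y : ZMod 4, (y = x ∨ y = x + 1) → x + 1 ≠ y + 2 := by decide
    exact key _ _ hpg (hbg ▸ hhg)

/-- all differences are even: `b g ∈ {a g, a g + 2}`. -/
theorem diff_even {a b : PT} (ha : a ∈ A) (hb : b ∈ A) (g : Fin 4) : b g = a g ∨ b g = a g + 2 := by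
  have h1 := diff_ne_one hA8 hN ha hb g
  have h3 : b g ≠ a g + 3 := fun e => diff_ne_one hA8 hN hb ha g (by rw [e, add_three_add_one])
  have key : ∀ x y : ZMod 4, y ≠ x + 1 → y ≠ x + 3 → y = x ∨ y = x + 2 := by decide
  exact key _ _ h1 h3

/-- **all differences lie in `E8`** (even entries, even weight). -/
theorem sub_mem_e8Set {a b : PT} (ha : a ∈ A) (hb : b ∈ A) : b - a ∈ e8Set := by
  have hev : ∀ f, (b - a) f = 0 ∨ (b - a) f = 2 := fun f => by
    rcases diff_even hA8 hN ha hb f with e | e <;> simp [e]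
  refine mem_e8Set.2 ⟨mem_evenSet.2 hev, ?_⟩
  by_contra hsum
  -- odd weight: one coordinate k differs from the three others
  obtain ⟨k, hk⟩ : ∃ k : Fin 4, ∀ f, f ≠ k → (b - a) f = (b - a) k + 2 := by
    have key : ∀ x₀ x₁ x₂ x₃ : ZMod 4, (x₀ = 0 ∨ x₀ = 2) → (x₁ = 0 ∨ x₁ = 2) → (x₂ = 0 ∨ x₂ = 2) → (x₃ = 0 ∨ x₃ = 2) →
        x₀ + x₁ + x₂ + x₃ ≠ 0 → ∃ k : Fin 4, ∀ f : Fin 4, f ≠ k → ![x₀, x₁, x₂, x₃] f = ![x₀, x₁, x₂, x₃] k + 2 := by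
      decide
    have hd : (b - a) = ![(b - a) 0, (b - a) 1, (b - a) 2, (b - a) 3] := by
      funext f; fin_cases f <;> rfl
    have hs : (b - a) 0 + (b - a) 1 + (b - a) 2 + (b - a) 3 ≠ 0 := by rwa [Fin.sum_univ_four] at hsum
    obtain ⟨k, hk⟩ := key _ _ _ _ (hev 0) (hev 1) (hev 2) (hev 3) hs
    exact ⟨k, fun f hf => by have := hk f hf; rwa [← hd] at this⟩
  have hab : a ≠ b := by
    rintro rfl; apply hsum; simp
  rcases hev k with hk0 | hk2
  · -- weight 3: (b - a) k = 0, others 2.  Partner p of a in the box (k : a k) × (g : a g), g ≠ k.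
    obtain ⟨g, k₂, hgk, hk2k, hgk2⟩ := exists_two_others k
    obtain ⟨k₃, hk3k, hk3g, hk32⟩ : ∃ k₃ : Fin 4, k₃ ≠ k ∧ k₃ ≠ g ∧ k₃ ≠ k₂ := by
      have key : ∀ k g k₂ : Fin 4, g ≠ k → k₂ ≠ k → g ≠ k₂ → ∃ k₃ : Fin 4, k₃ ≠ k ∧ k₃ ≠ g ∧ k₃ ≠ k₂ := by decide
      exact key k g k₂ hgk hk2k hgk2
    have haB : a ∈ box A k (a k) g (a g) := mem_box.2 ⟨ha, Or.inl rfl, Or.inl rfl⟩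
    obtain ⟨p, hpB, hpa⟩ := exists_partner hA8 hN (Ne.symm hgk) (a k) (a g) a
    obtain ⟨hp, hpk, hpg⟩ := mem_box.1 hpB
    have hp2 := opp_of_box hA8 hN (Ne.symm hgk) (a k) (a g) haB hpB (Ne.symm hpa) k₂ hk2k (Ne.symm hgk2)
    have hp3 := opp_of_box hA8 hN (Ne.symm hgk) (a k) (a g) haB hpB (Ne.symm hpa) k₃ hk3k hk3g
    have hx : ∀ f, f ≠ k → b f = a f + 2 := fun f hf => by
      have := hk f hf
      rw [hk0, zero_add, Pi.sub_apply, sub_eq_iff_eq_add, add_comm] at this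
      exact this
    have hb2 := hx k₂ hk2k
    have hb3 := hx k₃ hk3k
    have hbg := hx g hgk
    have hbk : b k = a k := by rw [Pi.sub_apply, sub_eq_zero] at hk0; exact hk0
    have hpb : p ≠ b := by
      rintro rfl
      have key : ∀ x : ZMod 4, ¬(x + 2 = x ∨ x + 2 = x + 1) := by decide
      exact key _ (hbg ▸ hpg)
    have hpB3 : p ∈ box A k₂ (b k₂) k₃ (b k₃) := mem_box.2 ⟨hp, Or.inl (hp2.trans hb2.symm), Or.inl (hp3.trans hb3.symm)⟩
    have hbB3 : b ∈ box A k₂ (b k₂) k₃ (b k₃) := mem_box.2 ⟨hb, Or.inl rfl, Or.inl rfl⟩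
    have hk' := opp_of_box hA8 hN hk32.symm (b k₂) (b k₃) hpB3 hbB3 hpb k (Ne.symm hk2k) (Ne.symm hk3k)
    -- b k = a k, p k ∈ {a k, a k + 1}: not opposite
    have key : ∀ x y : ZMod 4, (y = x ∨ y = x + 1) → x ≠ y + 2 := by decide
    exact key _ _ hpk (hbk ▸ hk')
  · -- weight 1: (b - a) k = 2, others 0: a, b agree on two coordinates but are not opposite on the third
    obtain ⟨g, k₂, hgk, hk2k, hgk2⟩ := exists_two_others k
    obtain ⟨k₃, hk3k, hk3g, hk32⟩ : ∃ k₃ : Fin 4, k₃ ≠ k ∧ k₃ ≠ g ∧ k₃ ≠ k₂ := by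
      have key : ∀ k g k₂ : Fin 4, g ≠ k → k₂ ≠ k → g ≠ k₂ → ∃ k₃ : Fin 4, k₃ ≠ k ∧ k₃ ≠ g ∧ k₃ ≠ k₂ := by decide
      exact key k g k₂ hgk hk2k hgk2
    have e0 : ∀ f, f ≠ k → b f = a f := fun f hf => by
      have := hk f hf; rw [hk2] at this
      have h4 : (2 : ZMod 4) + 2 = 0 := by decide
      rw [h4, Pi.sub_apply, sub_eq_zero] at this; exact this
    have haB : a ∈ box A k₂ (a k₂) k₃ (a k₃) := mem_box.2 ⟨ha, Or.inl rfl, Or.inl rfl⟩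
    have hbB : b ∈ box A k₂ (a k₂) k₃ (a k₃) := mem_box.2 ⟨hb, Or.inl (e0 k₂ hk2k), Or.inl (e0 k₃ hk3k)⟩
    have hg' := opp_of_box hA8 hN hk32.symm (a k₂) (a k₃) haB hbB hab g hgk2 (Ne.symm hk3g)
    rw [e0 g hgk] at hg'
    have key : ∀ x : ZMod 4, x ≠ x + 2 := by decide
    exact key _ hg'

/-- **the non-hosted case of the dichotomy**: `A` lies in the E8-coset of any of its points. -/
theorem subset_e8_coset {a : PT} (ha : a ∈ A) : A ⊆ e8Set.image (· + a) := by
  intro b hb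
  exact Finset.mem_image.2 ⟨b - a, sub_mem_e8Set hA8 hN ha hb, sub_add_cancel b a⟩

end structure_

/-! ### §7.4 The dichotomy, and `phaseTorusLaw8_holds` -/

/-- **THE 8-SET DICHOTOMY** (kernel): a set of at most 8 phases is box-hosted or lies in an E8-coset. -/
theorem eightDichotomy_holds : EightDichotomy := by
  intro A hA8
  by_cases hh : ∃ f₀ s, BoxHosted A f₀ s
  · exact Or.inl hh
  · push Not at hh
    right
    by_cases hne : A = ∅
    · exact ⟨0, by rw [hne]; exact Finset.empty_subset _⟩
    · obtain ⟨a, ha⟩ := Finset.nonempty_iff_ne_empty.2 hne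
      exact ⟨a, subset_e8_coset hA8 hh ha⟩


/-- **THE PHASE-TORUS LAW HOLDS AT CORANK 8** (kernel, unconditional; F1 target (a) `phaseTorusLaw8_holds`):
box-hosted law (`PhaseTorusLawProof.rot_step`) on hosted 8-sets, E8 law (`PhaseTorusLawE8`) on the others (§7.3). -/
theorem phaseTorusLaw8_holds : PhaseTorusLawN 8 := phaseTorusLawN_eight_of_dichotomy eightDichotomy_holds

/-- alias in the director's vocabulary (F1 target (b)). -/
theorem not_phaseTorusLaw16 : ¬ PhaseTorusLawN 16 := not_phaseTorusLawN_sixteen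

/-- **THRESHOLD (kernel part)**: true at every corank `≤ 8`, false at every corank `≥ 16` (`≤ 10` is `PhaseTorusLawTen`). -/
theorem threshold_kernel : (∀ γ, γ ≤ 8 → PhaseTorusLawN γ) ∧ (∀ γ, 16 ≤ γ → ¬ PhaseTorusLawN γ) :=
  ⟨fun _ h => phaseTorusLawN_mono h phaseTorusLaw8_holds, fun _ h => not_phaseTorusLawN_of_le h⟩

end Summit.Ventures.HSemireg.PhaseTorus
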